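import Summits.QuantumFields.BalabanUV.T4Continuum.Support.NE9PolydiscStepOffCentre

/-!
# NE9PolydiscRateLeast — ROUTE R4♯-T, the RATE INEQUALITY of `NE9PolydiscStepOffCentre` §0 DECIDED: the planner's quadratic
# test is necessary in the vertex regime, large rates are free, and THE LEAST ADMISSIBLE RATE has the closed form
# `μ*(c̄, t) = ((1 − c̄² + t²) − √(((1 − t)² − c̄²)((1 + t)² − c̄²))) ∕ (2t)` (PART A of the answer to the refuter's O-v12-1)

Cell `pub-balaban`, T4-DAG §2 node U3 ∕ §6 row NE9; NE9 crux team (coordinator ruling «YM REDIRECT» e34b3e0c (2)); leaf lineage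
`b2b-balaban-t4-ne9-formalise-leaf-04`, generation 51.  Companion of leaf-03 generation 44's (T-a) PART 1 `NE9PolydiscStepOffCentre`
(p260526), whose §0 displays the RATE INEQUALITY `(r₄² − ρ²)·r ≤ μ·r₄·(r² − (c̄ + ρ)²)` (`ρ ∈ [0, r₄]`) with three SUPPLIERS
(`rateIneq_crude`, `rateIneq_centred`, `rateIneq_of_quadTest`) and says — three times, in prose — that the refuter's `λ*(c̄, r₄)`
(PRICING-NE9 v10 (E10-1); v12 (C12-2) «least admissible μ = 0.35177 (grid) … three routes to one number») is «the least admissible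
`μ`».  THIS FILE makes that sentence a theorem and gives the number a closed form (the refuter's O-v12-1, PRICING-NE9 v12 §H, asks
for the CLASS-sharpness of this rate; PART B `NE9PolydiscStepOffCentreSharp` answers it with this file's `isLeast_rate`).

HONEST FRAMING (T4-DAG PAGE 1).  Rung (B)+1 of the FINITE-VOLUME T⁴ programme — NOT infinite volume, NOT a mass gap, NOT the Clay
problem.  NE9 (`T4OutputRate.NE9` ∧ `FadingMemory`) is a cell NEW ESTIMATE, NOT PRINTED in [I] = CMP **109**, [II] = CMP **116**, NOT
PROVED here or anywhere («NE9 ⇐ the named binders»; row WALLED ON A MODEL O-NE9-1; spine PROVED 0∕9).  This file is REAL ALGEBRA about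
one quadratic polynomial; no Bałaban object occurs.  Knowing the EXACT least rate of a lemma inside a CONDITIONAL END is bookkeeping for
the pricing desk (it closes «can μ be lowered by a cleverer certificate?» — no), NOT progress on the estimate.  HONEST DEPENDENCY (cell
line, verbatim): continuum YM on T⁴ ⇐ BetaPertH ∧ nine spine estimates (0/9 proved); BetaPertH ⇐ (D1) ∧ (D4) ∧ CAP+tail; G-an2-4
gates asym, D1 and NE2/3/4.

WHAT (unit radius `r = 1`, `r₄ = t`, centre bound `c̄`; all [folklore], 0 def, 0 sorry).  Write `Adm(λ) :⟺ ∀ ρ ∈ [0,t], t² − ρ² ≤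
λ·t·(1 − (c̄+ρ)²)` (displayed inline, never a definition) and `p(x) := x² − (1 − c̄² + t²)·x + t²`.
* §1 `rateIneq_mono` — `Adm` is an up-set in `λ`.
* §2 `quadTest_of_rateIneq` — for `λ(c̄ + t) ≤ 1`, `Adm(λ)` IMPLIES the planner's QUADRATIC TEST `(λtc̄)² ≤ (λt(1−c̄²) − t²)(1 − λt)`
  at `t′ = t` (read `Adm` at the vertex `ρ_v = λtc̄∕(1 − λt) ∈ [0, t]` and complete the square — `pointwise_of_quadTest` backwards);
  `rateIneq_of_large` — for `λ(c̄ + t) ≥ 1`, `Adm(λ)` holds FOR FREE (the parabola decreases on `[0,t]` and is `λt(1 − (c̄+t)²) ≥ 0`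
  at `ρ = t`); `rateIneq_iff_quadTest` — hence «`Adm` ⟺ quadratic test» in the vertex regime.
* §3 `quadTest_iff_poly` — the test is `p(λt) ≤ 0`.
* §4 **`isLeast_rate`** — `IsLeast {λ | Adm(λ)} μ*` with `μ* = ((1 − c̄² + t²) − √(((1−t)² − c̄²)((1+t)² − c̄²))) ∕ (2t)` for
  `0 ≤ c̄`, `0 < t`, `c̄ + t < 1` (`μ*·t` is the smaller root of `p`; `μ*(c̄ + t) ≤ 1` places it in the vertex regime; minimality from
  §2 and the factorisation `p(x) = (x − x₋)(x − x₊)`); `leastRate_centred` — at `c̄ = 0` the formula is `t` (`NE9PolydiscChain`'s rate).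
* §5 RECORD LETTERS `(c̄, t) = (1∕4, 17∕52)` (the owner's K2 `NE9HoloFamilyOffCentreEnd` §5 ∕ PRICING-NE9 v11–v12): `not_rateIneq_record_3517`
  (λ = 3517∕10000 FAILS at ρ = 4∕125), `rateIneq_record_3518` (λ = 1759∕5000 passes, quadratic test at t′ = t), hence
  **`leastRate_record_bracket : 0.3517 < μ*(1∕4, 17∕52) ≤ 0.3518`** (μ* = 0.3517652…; the desk's «0.35177 (grid)» ∕ «λ* = 0.3518»).
* §6 `rateIneq_iff_unit` — homogeneity: the radius-`r` inequality for `(r, c̄r, tr)` ⟺ the unit one for `(1, c̄, t)`;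
  `isLeast_rate_radius` — so the least rate at any radius is `μ*(c̄, t)` (the currency of PART 2 `NE9PolydiscChainOffCentre` and of
  the owner's K2 binder `hμ`).
DISGUISE TEST: real algebra; no inequality of the series; no Bałaban object; not NE9.  WHAT THIS DOES NOT DO: it does not touch the
chain lemma, the coupling half, the model O-NE9-1 or the displays `z`, `S`; CLASS-sharpness (no holomorphic-chain argument can beat
`μ*` on the displayed data) is PART B.

References: [FV1980] T. Franzoni, E. Vesentini, *Holomorphic Maps and Invariant Distances*, North-Holland Math. Studies 40 (1980),
ch. IV–V (TYPES ∕ loci only; nothing asserted).  Summits-side NEW work (LEAN PLACEMENT RULE); imports PART 1 `NE9PolydiscStepOffCentre`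
BY NAME (`rate_pos_unit`, `pointwise_of_quadTest`); modifies nothing; 0 sorry.
-/

noncomputable section

namespace Summit.QuantumFields.BalabanUV.T4Continuum.NE9PolydiscRateLeast

open Set
open Summit.QuantumFields.BalabanUV.T4Continuum.NE9PolydiscStepOffCentre (rate_pos_unit pointwise_of_quadTest)

/-! ## §1 Admissibility is an up-set in the rate -/

/-- MONOTONICITY: if `λ ≤ λ′` and `λ` is admissible for `(1, c̄, t)` (`0 < t`, `0 ≤ c̄`, `c̄ + t < 1`) then so is `λ′`
(the weight `1 − (c̄+ρ)²` is nonnegative on `[0,t]`). [folklore] -/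
theorem rateIneq_mono {t cb lam lam' : ℝ} (ht : 0 < t) (hle : lam ≤ lam')
    (h : ∀ ρ ∈ Icc (0:ℝ) t, t ^ 2 - ρ ^ 2 ≤ lam * t * (1 - (cb + ρ) ^ 2)) (h1 : cb + t < 1) (hcb : 0 ≤ cb) :
    ∀ ρ ∈ Icc (0:ℝ) t, t ^ 2 - ρ ^ 2 ≤ lam' * t * (1 - (cb + ρ) ^ 2) := by
  intro ρ hρ
  have hpos : 0 ≤ 1 - (cb + ρ) ^ 2 := by nlinarith [hρ.1, hρ.2]
  have h0 := h ρ hρ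
  nlinarith [mul_nonneg (mul_nonneg (sub_nonneg.2 hle) ht.le) hpos]

/-! ## §2 The vertex regime `λ(c̄+t) ≤ 1`: the quadratic test is necessary; large rates are free -/

/-- NECESSITY OF THE QUADRATIC TEST.  In the regime `λ(c̄ + t) ≤ 1` an admissible `λ` passes the planner's quadratic test at
`t′ = t`: the vertex `ρ_v = λtc̄∕(1 − λt)` of the test parabola lies in `[0, t]`, and the rate inequality read at `ρ_v` is —
after completing the square as in `pointwise_of_quadTest` — exactly `(λtc̄)² ≤ (λt(1 − c̄²) − t²)(1 − λt)`. [folklore] -/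
theorem quadTest_of_rateIneq {t cb lam : ℝ} (ht : 0 < t) (hcb : 0 ≤ cb) (h1 : cb + t < 1)
    (hsmall : lam * (cb + t) ≤ 1)
    (h : ∀ ρ ∈ Icc (0:ℝ) t, t ^ 2 - ρ ^ 2 ≤ lam * t * (1 - (cb + ρ) ^ 2)) :
    (lam * t * cb) ^ 2 ≤ (lam * t * (1 - cb ^ 2) - t ^ 2) * (1 - lam * t) := by
  have hlam : 0 < lam := rate_pos_unit hcb ht h1 h
  have hlt1 : lam * t ≤ 1 := by nlinarith [mul_nonneg hlam.le hcb]
  rcases hlt1.lt_or_eq with hlt | heq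
  · have h1m : 0 < 1 - lam * t := sub_pos.2 hlt
    have h1m' : 1 - lam * t ≠ 0 := h1m.ne'
    set ρv : ℝ := lam * t * cb / (1 - lam * t) with hρv
    have hρv0 : 0 ≤ ρv := div_nonneg (mul_nonneg (mul_nonneg hlam.le ht.le) hcb) h1m.le
    have hzero : (1 - lam * t) * ρv = lam * t * cb := by
      rw [hρv]; field_simp
    have hρvt : ρv ≤ t := by
      by_contra hgt
      push Not at hgt
      have : (1 - lam * t) * t < (1 - lam * t) * ρv := mul_lt_mul_of_pos_left hgt h1m
      rw [hzero] at this
      nlinarith [mul_nonneg hlam.le hcb]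
    have hq := h ρv ⟨hρv0, hρvt⟩
    have hid : (1 - lam * t) * (lam * t * (1 - (cb + ρv) ^ 2) - (t ^ 2 - ρv ^ 2)) =
        ((1 - lam * t) * ρv - lam * t * cb) ^ 2 + ((lam * t * (1 - cb ^ 2) - t ^ 2) * (1 - lam * t) -
          (lam * t * cb) ^ 2) := by ring
    have hsq0 : (1 - lam * t) * ρv - lam * t * cb = 0 := by rw [hzero]; ring
    have hnn : 0 ≤ (1 - lam * t) * (lam * t * (1 - (cb + ρv) ^ 2) - (t ^ 2 - ρv ^ 2)) :=
      mul_nonneg h1m.le (sub_nonneg.2 hq)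
    rw [hid, hsq0] at hnn
    linarith
  · have hcb0 : lam * cb = 0 := by nlinarith [mul_nonneg hlam.le hcb]
    have h0 : lam * t * cb = 0 := by
      calc lam * t * cb = t * (lam * cb) := by ring
        _ = 0 := by rw [hcb0, mul_zero]
    rw [h0, heq]; norm_num

/-- LARGE RATES ARE FREE.  For `λ(c̄ + t) ≥ 1` (`0 < t`, `0 ≤ c̄`, `c̄ + t < 1`) the rate inequality holds with NO further test:
the parabola `ρ ↦ λt(1 − (c̄+ρ)²) − (t² − ρ²)` is non-increasing on `[0, t]` and equals `λt(1 − (c̄+t)²) ≥ 0` at `ρ = t`.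
(So the admissible set always contains `[1∕(c̄+t), ∞)`.) [folklore] -/
theorem rateIneq_of_large {t cb lam : ℝ} (ht : 0 < t) (hcb : 0 ≤ cb) (h1 : cb + t < 1)
    (hlarge : 1 ≤ lam * (cb + t)) :
    ∀ ρ ∈ Icc (0:ℝ) t, t ^ 2 - ρ ^ 2 ≤ lam * t * (1 - (cb + ρ) ^ 2) := by
  intro ρ hρ
  have hθ : 0 < cb + t := by linarith
  have hlam : 0 < lam := by
    by_contra hle
    push Not at hle
    nlinarith [mul_nonneg (neg_nonneg.2 hle) hθ.le]
  have h1θ : 0 ≤ 1 - (cb + t) ^ 2 := by nlinarith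
  have hQt : 0 ≤ lam * t * (1 - (cb + t) ^ 2) := mul_nonneg (mul_nonneg hlam.le ht.le) h1θ
  have hfac : lam * t * (1 - (cb + ρ) ^ 2) - (t ^ 2 - ρ ^ 2) - lam * t * (1 - (cb + t) ^ 2)
      = (ρ - t) * ((1 - lam * t) * (ρ + t) - 2 * lam * t * cb) := by ring
  have hB : (1 - lam * t) * (ρ + t) - 2 * lam * t * cb ≤ 0 := by
    rcases le_or_gt 0 (1 - lam * t) with hpos | hneg
    · have h2 : (1 - lam * t) * (ρ + t) ≤ (1 - lam * t) * (2 * t) :=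
        mul_le_mul_of_nonneg_left (by linarith [hρ.2]) hpos
      have h3 : (1 - lam * t) * (2 * t) - 2 * lam * t * cb = 2 * t * (1 - lam * (cb + t)) := by ring
      have h4 : 2 * t * (1 - lam * (cb + t)) ≤ 0 :=
        mul_nonpos_iff.2 (Or.inl ⟨by linarith, by linarith⟩)
      linarith
    · have h2 : (1 - lam * t) * (ρ + t) ≤ 0 :=
        mul_nonpos_iff.2 (Or.inr ⟨hneg.le, by linarith [hρ.1]⟩)
      nlinarith [mul_nonneg (mul_nonneg hlam.le ht.le) hcb]
  have hA : ρ - t ≤ 0 := by linarith [hρ.2]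
  have hprod : 0 ≤ (ρ - t) * ((1 - lam * t) * (ρ + t) - 2 * lam * t * cb) :=
    mul_nonneg_of_nonpos_of_nonpos hA hB
  rw [← hfac] at hprod
  linarith

/-- IN THE VERTEX REGIME `λ(c̄ + t) ≤ 1`, `λt < 1`: admissible ⟺ the quadratic test at `t′ = t` (§2 forward, PART 1's
`pointwise_of_quadTest` backward). [folklore] -/
theorem rateIneq_iff_quadTest {t cb lam : ℝ} (ht : 0 < t) (hcb : 0 ≤ cb) (h1 : cb + t < 1)
    (hsmall : lam * (cb + t) ≤ 1) (hlt : lam * t < 1) :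
    (∀ ρ ∈ Icc (0:ℝ) t, t ^ 2 - ρ ^ 2 ≤ lam * t * (1 - (cb + ρ) ^ 2)) ↔
      (lam * t * cb) ^ 2 ≤ (lam * t * (1 - cb ^ 2) - t ^ 2) * (1 - lam * t) :=
  ⟨quadTest_of_rateIneq ht hcb h1 hsmall, fun hq ρ _ => pointwise_of_quadTest hlt hq ρ⟩

/-! ## §3 The test as the quadratic polynomial `p(x) = x² − (1 − c̄² + t²)x + t²` at `x = λt` -/

/-- The quadratic test at `t′ = t` IS `p(λt) ≤ 0` with `p(x) = x² − (1 − c̄² + t²)·x + t²` (an identity of the two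
differences). [folklore] -/
theorem quadTest_iff_poly {t cb lam : ℝ} :
    (lam * t * cb) ^ 2 ≤ (lam * t * (1 - cb ^ 2) - t ^ 2) * (1 - lam * t) ↔
      (lam * t) ^ 2 - (1 - cb ^ 2 + t ^ 2) * (lam * t) + t ^ 2 ≤ 0 := by
  have hid : (lam * t * (1 - cb ^ 2) - t ^ 2) * (1 - lam * t) - (lam * t * cb) ^ 2
      = -((lam * t) ^ 2 - (1 - cb ^ 2 + t ^ 2) * (lam * t) + t ^ 2) := by ring
  constructor <;> intro h <;> linarith

/-! ## §4 THE LEAST ADMISSIBLE RATE, closed form -/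

/-- **THE LEAST ADMISSIBLE RATE.**  For `0 ≤ c̄`, `0 < t`, `c̄ + t < 1` the set of admissible rates
`{λ | ∀ ρ ∈ [0,t], t² − ρ² ≤ λ·t·(1 − (c̄+ρ)²)}` of PART 1 §0 (unit radius, `r₄ = t`) has the LEAST element
`μ*(c̄, t) = ((1 − c̄² + t²) − √(((1 − t)² − c̄²)·((1 + t)² − c̄²))) ∕ (2t)`
— `μ*·t` is the smaller root `x₋` of `p(x) = x² − (1 − c̄² + t²)x + t²` (discriminant `((1−t)² − c̄²)((1+t)² − c̄²) > 0`),
`μ*t < 1` and `μ*(c̄ + t) ≤ 1` (the identity `(s(c̄+t))² − (B(c̄+t) − 2t)² = 4tc̄(1 − (c̄+t)²)`, `B = 1 − c̄² + t²`, `s = √Δ`), so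
`μ*` is admissible by `pointwise_of_quadTest` (the test holds with EQUALITY), and no `λ < μ*` is: in the vertex regime §2 gives
`p(λt) ≤ 0`, impossible left of `x₋` since `p(x) = (x − x₋)(x − x₊)`; outside it `λ > 1∕(c̄+t) ≥ μ*`.  This is the refuter's
`λ*(c̄, r₄)` of PRICING-NE9 v10 (E10-1) ∕ v12 (C12-2) in closed form. [folklore] -/
theorem isLeast_rate {t cb : ℝ} (ht : 0 < t) (hcb : 0 ≤ cb) (h1 : cb + t < 1) :
    IsLeast {lam : ℝ | ∀ ρ ∈ Icc (0:ℝ) t, t ^ 2 - ρ ^ 2 ≤ lam * t * (1 - (cb + ρ) ^ 2)}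
      ((1 - cb ^ 2 + t ^ 2 - Real.sqrt (((1 - t) ^ 2 - cb ^ 2) * ((1 + t) ^ 2 - cb ^ 2))) / (2 * t)) := by
  set B : ℝ := 1 - cb ^ 2 + t ^ 2 with hB
  set D : ℝ := ((1 - t) ^ 2 - cb ^ 2) * ((1 + t) ^ 2 - cb ^ 2) with hD
  have hD0 : 0 < D := by
    have h1' : 0 < (1 - t) ^ 2 - cb ^ 2 := by nlinarith
    have h2' : 0 < (1 + t) ^ 2 - cb ^ 2 := by nlinarith
    exact mul_pos h1' h2'
  have hDB : D = B ^ 2 - 4 * t ^ 2 := by rw [hD, hB]; ring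
  set s : ℝ := Real.sqrt D with hs
  have hs0 : 0 ≤ s := Real.sqrt_nonneg D
  have hss : s ^ 2 = B ^ 2 - 4 * t ^ 2 := (Real.sq_sqrt hD0.le).trans hDB
  have h2t : 0 < 2 * t := by linarith
  have hθ : 0 < cb + t := by linarith
  set μ : ℝ := (B - s) / (2 * t) with hμ
  have hμt : μ * t = (B - s) / 2 := by
    rw [hμ]; field_simp
  have hp0 : (μ * t) ^ 2 - B * (μ * t) + t ^ 2 = 0 := by
    rw [hμt]; linear_combination (1 / 4 : ℝ) * hss
  have hB2 : B < 2 := by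
    rw [hB]; nlinarith [mul_pos ht (by linarith : (0:ℝ) < 1 - t)]
  have hμt1 : μ * t < 1 := by rw [hμt]; linarith
  have hμθ : μ * (cb + t) ≤ 1 := by
    rw [hμ, div_mul_eq_mul_div, div_le_one h2t]
    have hkey : B * (cb + t) - 2 * t ≤ s * (cb + t) := by
      by_cases hle : B * (cb + t) - 2 * t ≤ 0
      · exact hle.trans (mul_nonneg hs0 hθ.le)
      · push Not at hle
        have hid : (s * (cb + t)) ^ 2 - (B * (cb + t) - 2 * t) ^ 2 = 4 * t * cb * (1 - (cb + t) ^ 2) := by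
          rw [mul_pow, hss, hB]; ring
        have hnn : 0 ≤ 4 * t * cb * (1 - (cb + t) ^ 2) := by
          have : 0 ≤ 1 - (cb + t) ^ 2 := by nlinarith
          positivity
        have hsq : (B * (cb + t) - 2 * t) ^ 2 ≤ (s * (cb + t)) ^ 2 := by linarith
        have hb0 : 0 ≤ s * (cb + t) := mul_nonneg hs0 hθ.le
        exact le_of_sq_le_sq hsq hb0
    have hsplit : (B - s) * (cb + t) = B * (cb + t) - s * (cb + t) := by ring
    rw [hsplit]; linarith
  constructor
  · intro ρ _
    have hq : (μ * t * cb) ^ 2 ≤ (μ * t * (1 - cb ^ 2) - t ^ 2) * (1 - μ * t) := by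
      rw [quadTest_iff_poly, ← hB]; exact hp0.le
    exact pointwise_of_quadTest hμt1 hq ρ
  · intro lam hlam
    by_contra hlt
    push Not at hlt
    rcases le_or_gt (lam * (cb + t)) 1 with hsm | hlg
    · have hq := quadTest_of_rateIneq ht hcb h1 hsm hlam
      rw [quadTest_iff_poly, ← hB] at hq
      have hx : lam * t < (B - s) / 2 := by rw [← hμt]; exact mul_lt_mul_of_pos_right hlt ht
      have hfac : (lam * t) ^ 2 - B * (lam * t) + t ^ 2 = (lam * t - (B - s) / 2) * (lam * t - (B + s) / 2) := by
        linear_combination (1 / 4 : ℝ) * hss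
      have hpos : 0 < (lam * t - (B - s) / 2) * (lam * t - (B + s) / 2) := by
        apply mul_pos_of_neg_of_neg <;> linarith
      rw [← hfac] at hpos
      linarith
    · have : lam * (cb + t) < μ * (cb + t) := mul_lt_mul_of_pos_right hlt hθ
      linarith

/-- THE CENTRED CASE: at `c̄ = 0` the closed form is `t` — `NE9PolydiscChain`'s rate `θ` at `t = θ` (cf. PART 1's
`rateIneq_centred`). [folklore] -/
theorem leastRate_centred {t : ℝ} (ht : 0 < t) (h1 : t < 1) :
    (1 - (0:ℝ) ^ 2 + t ^ 2 - Real.sqrt (((1 - t) ^ 2 - (0:ℝ) ^ 2) * ((1 + t) ^ 2 - (0:ℝ) ^ 2))) / (2 * t) = t := by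
  have hprod : ((1 - t) ^ 2 - (0:ℝ) ^ 2) * ((1 + t) ^ 2 - (0:ℝ) ^ 2) = (1 - t ^ 2) ^ 2 := by ring
  have h1t : 0 ≤ 1 - t ^ 2 := by nlinarith
  rw [hprod, Real.sqrt_sq h1t]
  field_simp
  ring

/-! ## §5 Record letters `(c̄, t) = (1∕4, 17∕52)`: the third digit of `μ*` -/

/-- At the record letters `(c̄, t) = (1∕4, 17∕52)` the rate `λ = 3517∕10000` is NOT admissible: the rate inequality FAILS at
`ρ = 4∕125` (near the vertex `ρ_v = 0.0325`). [folklore] -/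
theorem not_rateIneq_record_3517 :
    ¬ ∀ ρ ∈ Icc (0:ℝ) (17 / 52), (17 / 52 : ℝ) ^ 2 - ρ ^ 2 ≤ 3517 / 10000 * (17 / 52) * (1 - (1 / 4 + ρ) ^ 2) := by
  intro h
  have := h (4 / 125) ⟨by norm_num, by norm_num⟩
  norm_num at this

/-- At the record letters `(c̄, t) = (1∕4, 17∕52)` the rate `λ = 1759∕5000 = 0.3518` IS admissible (the quadratic test at
`t′ = t`, a `norm_num` certificate, through PART 1's `pointwise_of_quadTest`). [folklore] -/
theorem rateIneq_record_3518 :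
    ∀ ρ ∈ Icc (0:ℝ) (17 / 52), (17 / 52 : ℝ) ^ 2 - ρ ^ 2 ≤ 1759 / 5000 * (17 / 52) * (1 - (1 / 4 + ρ) ^ 2) :=
  fun ρ _ => pointwise_of_quadTest (t' := 17 / 52) (cb := 1 / 4) (lam := 1759 / 5000) (by norm_num) (by norm_num) ρ

/-- **THIRD-DIGIT BRACKET AT THE RECORD LETTERS**: `0.3517 < μ*(1∕4, 17∕52) ≤ 0.3518` (μ* = 0.3517652…; PRICING-NE9 v12
(C12-2) «0.35177 (grid)», v10∕v11 «λ* = 0.3518»; the certified rows `44∕125` (K2 §5, PART 2) and `9∕25` lie above). [folklore] -/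
theorem leastRate_record_bracket :
    (3517 / 10000 : ℝ) < (1 - (1 / 4 : ℝ) ^ 2 + (17 / 52 : ℝ) ^ 2
        - Real.sqrt (((1 - 17 / 52) ^ 2 - (1 / 4 : ℝ) ^ 2) * ((1 + 17 / 52) ^ 2 - (1 / 4 : ℝ) ^ 2))) / (2 * (17 / 52)) ∧
    (1 - (1 / 4 : ℝ) ^ 2 + (17 / 52 : ℝ) ^ 2
        - Real.sqrt (((1 - 17 / 52) ^ 2 - (1 / 4 : ℝ) ^ 2) * ((1 + 17 / 52) ^ 2 - (1 / 4 : ℝ) ^ 2))) / (2 * (17 / 52))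
      ≤ 1759 / 5000 := by
  have hL := isLeast_rate (t := 17 / 52) (cb := 1 / 4) (by norm_num) (by norm_num) (by norm_num)
  refine ⟨?_, hL.2 rateIneq_record_3518⟩
  by_contra hle
  push Not at hle
  exact not_rateIneq_record_3517 (rateIneq_mono (by norm_num) hle hL.1 (by norm_num) (by norm_num))

/-! ## §6 Homogeneity in the radius -/

/-- HOMOGENEITY: the radius-`r` rate inequality of PART 1 ∕ PART 2 for `(r, c̄·r, t·r)` is equivalent to the unit one for
`(1, c̄, t)` (substitute `ρ = σ·r`, divide by `r³`). [folklore] -/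
theorem rateIneq_iff_unit {r t cb lam : ℝ} (hr : 0 < r) :
    (∀ ρ ∈ Icc (0:ℝ) (t * r), ((t * r) ^ 2 - ρ ^ 2) * r ≤ lam * (t * r) * (r ^ 2 - (cb * r + ρ) ^ 2)) ↔
      (∀ σ ∈ Icc (0:ℝ) t, t ^ 2 - σ ^ 2 ≤ lam * t * (1 - (cb + σ) ^ 2)) := by
  have hr3 : 0 < r ^ 3 := pow_pos hr 3
  constructor
  · intro h σ hσ
    have hρ : σ * r ∈ Icc (0:ℝ) (t * r) :=
      ⟨mul_nonneg hσ.1 hr.le, mul_le_mul_of_nonneg_right hσ.2 hr.le⟩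
    have h0 := h (σ * r) hρ
    have hid1 : ((t * r) ^ 2 - (σ * r) ^ 2) * r = r ^ 3 * (t ^ 2 - σ ^ 2) := by ring
    have hid2 : lam * (t * r) * (r ^ 2 - (cb * r + σ * r) ^ 2) = r ^ 3 * (lam * t * (1 - (cb + σ) ^ 2)) := by ring
    rw [hid1, hid2] at h0
    exact le_of_mul_le_mul_left h0 hr3
  · intro h ρ hρ
    have hσ : ρ / r ∈ Icc (0:ℝ) t :=
      ⟨div_nonneg hρ.1 hr.le, (div_le_iff₀ hr).2 hρ.2⟩
    have h0 := h (ρ / r) hσ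
    have hρ' : ρ = ρ / r * r := (div_mul_cancel₀ ρ hr.ne').symm
    have h1 : r ^ 3 * (t ^ 2 - (ρ / r) ^ 2) ≤ r ^ 3 * (lam * t * (1 - (cb + ρ / r) ^ 2)) :=
      mul_le_mul_of_nonneg_left h0 hr3.le
    calc ((t * r) ^ 2 - ρ ^ 2) * r = r ^ 3 * (t ^ 2 - (ρ / r) ^ 2) := by
          conv_lhs => rw [hρ']
          ring
      _ ≤ r ^ 3 * (lam * t * (1 - (cb + ρ / r) ^ 2)) := h1
      _ = lam * (t * r) * (r ^ 2 - (cb * r + ρ) ^ 2) := by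
          conv_rhs => rw [hρ']
          ring

/-- THE LEAST RATE AT RADIUS `r`: for `(r, c̄r, tr)` (`0 < r`, `0 ≤ c̄`, `0 < t`, `c̄ + t < 1`) the admissible set of PART 2's ∕
the owner's K2's binder `hμ` has least element `μ*(c̄, t)` — the same closed form (§4 through §6's homogeneity). [folklore] -/
theorem isLeast_rate_radius {r t cb : ℝ} (hr : 0 < r) (ht : 0 < t) (hcb : 0 ≤ cb) (h1 : cb + t < 1) :
    IsLeast {lam : ℝ | ∀ ρ ∈ Icc (0:ℝ) (t * r),
        ((t * r) ^ 2 - ρ ^ 2) * r ≤ lam * (t * r) * (r ^ 2 - (cb * r + ρ) ^ 2)}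
      ((1 - cb ^ 2 + t ^ 2 - Real.sqrt (((1 - t) ^ 2 - cb ^ 2) * ((1 + t) ^ 2 - cb ^ 2))) / (2 * t)) := by
  have hset : {lam : ℝ | ∀ ρ ∈ Icc (0:ℝ) (t * r),
        ((t * r) ^ 2 - ρ ^ 2) * r ≤ lam * (t * r) * (r ^ 2 - (cb * r + ρ) ^ 2)} =
      {lam : ℝ | ∀ σ ∈ Icc (0:ℝ) t, t ^ 2 - σ ^ 2 ≤ lam * t * (1 - (cb + σ) ^ 2)} := by
    ext lam; exact rateIneq_iff_unit hr
  rw [hset]; exact isLeast_rate ht hcb h1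

end Summit.QuantumFields.BalabanUV.T4Continuum.NE9PolydiscRateLeast

end
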